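import Mathlib.Analysis.SpecialFunctions.Trigonometric.Series
import Mathlib.Analysis.SpecialFunctions.Pow.Real
import Mathlib.Analysis.MeanInequalities
import Mathlib.Analysis.Complex.Exponential
import Mathlib.Analysis.Complex.ExponentialBounds
import Mathlib.Algebra.Order.Field.GeomSum
import Mathlib.MeasureTheory.Integral.Bochner.Set
import Mathlib.Probability.ConditionalProbability
import HarnessLib

/-!
# Capped exponential moments from hypercontractive (even) moments — the engine of the SECOND CLAUSE `∫ e^{4|W|} dν ≤ 4`
# of stub E `stub_tiltMoments` (LINE-17 «hypercontractive second-order tilt expansion», crux `AllWindowsColdBox.BoxMidWindowsSU22`,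
# stmt-QuantumFields-24003; STUB-PLAN-E-24003 §2 E(7))

A polynomial chaos `X` of degree `m ≥ 3` under a Gaussian measure has only `exp(c|x|^{2/m})` integrability, so `∫ e^{λ|X|}` is
infinite; what the line needs is the exponential moment of `X` RESTRICTED to an event `S` on which `|X| ≤ M` (a cap), in the regime
`λ^m σ² M^{m−2} → 0` (`σ² = E X²`).  This file proves that bound from the EVEN MOMENTS alone — no layer-cake formula, no tail
estimates:

* `cosh_le_sum_add` : `cosh y ≤ Σ_{k<K} y^{2k}/(2k)! + (y^{2K}/(2K)!)·cosh y` (power series of `cosh`, `(2K)!(2j)! ≤ (2K+2j)!`);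
* `exp_abs_le_of_abs_le` : `|y| ≤ L ⇒ e^{|y|} ≤ 2Σ_{k<K} y^{2k}/(2k)! + 2e^L·y^{2K}/(2K)!` (`e^{|y|} ≤ 2cosh y ≤ 2e^L`);
* `setIntegral_exp_mul_abs_le` : on a set `S` where `|X| ≤ M`,
  `∫_S e^{λ|X|} dμ ≤ 2Σ_{k<K} λ^{2k} E_μ[X^{2k}]/(2k)! + 2e^{λM} λ^{2K} E_μ[X^{2K}]/(2K)!` (moments under the UNCONDITIONED `μ`);
* `setIntegral_exp_mul_abs_le_of_moments` : if moreover `E_μ[X^{2k}] ≤ (2k−1)^{km} σ^{2k}` for all `k ≥ 1` (the output shape of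
  Gaussian hypercontractivity for a degree-`m` polynomial, `m ≥ 2`) then, with `δ := e·λσ·√((λM+4)^{m−2}) ≤ 1/3`,
  `∫_S e^{λ|X|} dμ ≤ 2·μ(univ) + 20·δ²` (via `(2k)! ≥ (2k/e)^{2k}` = Mathlib `Real.pow_div_factorial_le_exp`, `K := ⌈λM/2⌉₊ + 1`);
* the three-term split `e^{a+b+c} ≤ (e^{3a}+e^{3b}+e^{3c})/3` (no Hölder) inside the abstract assembler
  `setIntegral_exp_mul_abs_le_of_three` / `integral_cond_exp_mul_abs_le_of_three` for `|W| ≤ |X₁|+|X₂|+|X₃|+c₀` on `S`, `ν = μ[|S]`,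
  and the numerical closing `cond_bound_le_four` (mass `≥ 9/10`, `e^{λc₀} ≤ 11/10`, each capped moment `≤ 11/5` ⇒ `≤ 4`).

Pure Mathlib; no definition.  HONEST LABEL: generic helper toward an open registered stub of a critic-PASSed line on the R2ξ″
RECORD-rung crux 24003; no stub is proved by name, no crux/rung/summit is proved; the Yang–Mills mass gap is NOT proved by this file.
-/

set_option autoImplicit false

noncomputable section

open Real Finset MeasureTheory ProbabilityTheory

namespace Summit.QuantumFields.YangMills.Theorems.AllWindowsColdBox.CappedExpMoment

/-! ## The `cosh` power series, truncated -/

/-- The terms `y^{2k}/(2k)!` of the power series of `cosh` are nonnegative. -/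
theorem cterm_nonneg (y : ℝ) (k : ℕ) : 0 ≤ y ^ (2 * k) / ((2 * k).factorial : ℝ) := by
  have : 0 ≤ y ^ (2 * k) := by rw [pow_mul]; positivity
  positivity

/-- `(2K)!·(2j)! ≤ (2(j+K))!`, the factorial inequality behind the tail bound. -/
theorem factorial_mul_le (K j : ℕ) :
    ((2 * K).factorial : ℝ) * ((2 * j).factorial : ℝ) ≤ ((2 * (j + K)).factorial : ℝ) := by
  have h := Nat.le_of_dvd (Nat.factorial_pos _) (Nat.factorial_mul_factorial_dvd_factorial_add (2 * K) (2 * j))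
  have h' : 2 * K + 2 * j = 2 * (j + K) := by ring
  rw [h'] at h
  exact_mod_cast h

/-- Shifted terms of the `cosh` series are dominated: `y^{2(j+K)}/(2(j+K))! ≤ (y^{2K}/(2K)!)·(y^{2j}/(2j)!)`. -/
theorem cterm_add_le (y : ℝ) (K j : ℕ) :
    y ^ (2 * (j + K)) / ((2 * (j + K)).factorial : ℝ) ≤
      y ^ (2 * K) / ((2 * K).factorial : ℝ) * (y ^ (2 * j) / ((2 * j).factorial : ℝ)) := by
  rw [div_mul_div_comm, ← pow_add, show 2 * K + 2 * j = 2 * (j + K) by ring]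
  have hnum : 0 ≤ y ^ (2 * (j + K)) := by rw [pow_mul]; positivity
  exact div_le_div_of_nonneg_left hnum (by positivity) (factorial_mul_le K j)

/-- **Truncated `cosh` series with a multiplicative tail**: `cosh y ≤ Σ_{k<K} y^{2k}/(2k)! + (y^{2K}/(2K)!)·cosh y`. -/
theorem cosh_le_sum_add (y : ℝ) (K : ℕ) :
    Real.cosh y ≤ ∑ k ∈ range K, y ^ (2 * k) / ((2 * k).factorial : ℝ) +
      y ^ (2 * K) / ((2 * K).factorial : ℝ) * Real.cosh y := by
  set c : ℕ → ℝ := fun k => y ^ (2 * k) / ((2 * k).factorial : ℝ) with hc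
  have hsum : HasSum c (Real.cosh y) := Real.hasSum_cosh y
  have hs : Summable c := hsum.summable
  have hsplit : Real.cosh y = ∑ k ∈ range K, c k + ∑' j, c (j + K) := by
    rw [← hsum.tsum_eq, hs.sum_add_tsum_nat_add K]
  have hshift : Summable (fun j => c (j + K)) := (summable_nat_add_iff K).2 hs
  have htail : ∑' j, c (j + K) ≤ c K * Real.cosh y := by
    rw [← hsum.tsum_eq, ← tsum_mul_left]
    exact hshift.tsum_le_tsum (fun j => cterm_add_le y K j) (hs.mul_left _)
  calc Real.cosh y = ∑ k ∈ range K, c k + ∑' j, c (j + K) := hsplit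
    _ ≤ ∑ k ∈ range K, c k + c K * Real.cosh y := by linarith

/-- **Capped exponential vs. even powers**: if `|y| ≤ L` then `e^{|y|} ≤ 2Σ_{k<K} y^{2k}/(2k)! + 2e^{L}·y^{2K}/(2K)!`
(from `e^{|y|} ≤ 2cosh y ≤ 2e^{|y|}` — cf. the tree's `LongRangeIsing.exp_abs_le_two_mul_cosh` / `DeBruijn1950.cosh_le_exp_abs`,
re-derived inline to keep this file Mathlib-only). -/
theorem exp_abs_le_of_abs_le {y L : ℝ} (hL : |y| ≤ L) (K : ℕ) :
    Real.exp |y| ≤ 2 * ∑ k ∈ range K, y ^ (2 * k) / ((2 * k).factorial : ℝ) +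
      2 * Real.exp L * (y ^ (2 * K) / ((2 * K).factorial : ℝ)) := by
  have hc := cosh_le_sum_add y K
  have h₁ : Real.exp y ≤ Real.exp |y| := Real.exp_le_exp.2 (le_abs_self y)
  have h₂ : Real.exp (-y) ≤ Real.exp |y| := Real.exp_le_exp.2 (neg_le_abs y)
  have hcosh : Real.cosh y ≤ Real.exp L := by
    rw [Real.cosh_eq]; linarith [Real.exp_le_exp.2 hL]
  have htwo : Real.exp |y| ≤ 2 * Real.cosh y := by
    rw [Real.cosh_eq]
    rcases le_or_gt 0 y with hy | hy
    · rw [abs_of_nonneg hy]; nlinarith [Real.exp_pos (-y)]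
    · rw [abs_of_neg hy]; nlinarith [Real.exp_pos y]
  have hK : 0 ≤ y ^ (2 * K) / ((2 * K).factorial : ℝ) := cterm_nonneg y K
  nlinarith [mul_le_mul_of_nonneg_left hcosh hK]

/-! ## Integrated form -/

section Integral

variable {Ω : Type*} [MeasurableSpace Ω]

/-- **Capped exponential moment from even moments**: if `|X| ≤ M` on the measurable set `S`, `X` is a.e.-strongly measurable and its
even powers up to `2K` are integrable, then for `λ ≥ 0`
`∫_S e^{λ|X|} dμ ≤ 2Σ_{k<K} λ^{2k}·E_μ[X^{2k}]/(2k)! + 2e^{λM}·λ^{2K}E_μ[X^{2K}]/(2K)!` (all moments under the unconditioned `μ`). -/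
theorem setIntegral_exp_mul_abs_le (μ : Measure Ω) [IsFiniteMeasure μ] {S : Set Ω} (hS : MeasurableSet S)
    {X : Ω → ℝ} (hX : AEStronglyMeasurable X μ) {lam M : ℝ} (hlam : 0 ≤ lam)
    (hM : ∀ ω ∈ S, |X ω| ≤ M) (K : ℕ) (hint : ∀ k, k ≤ K → Integrable (fun ω => X ω ^ (2 * k)) μ) :
    ∫ ω in S, Real.exp (lam * |X ω|) ∂μ ≤
      2 * ∑ k ∈ range K, lam ^ (2 * k) * (∫ ω, X ω ^ (2 * k) ∂μ) / ((2 * k).factorial : ℝ) +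
        2 * Real.exp (lam * M) * (lam ^ (2 * K) * (∫ ω, X ω ^ (2 * K) ∂μ) / ((2 * K).factorial : ℝ)) := by
  -- the pointwise majorant
  set g : Ω → ℝ := fun ω => 2 * ∑ k ∈ range K, (lam * X ω) ^ (2 * k) / ((2 * k).factorial : ℝ) +
      2 * Real.exp (lam * M) * ((lam * X ω) ^ (2 * K) / ((2 * K).factorial : ℝ)) with hg
  have hpt : ∀ ω ∈ S, Real.exp (lam * |X ω|) ≤ g ω := by
    intro ω hω
    have habs : |lam * X ω| ≤ lam * M := by
      rw [abs_mul, abs_of_nonneg hlam]; exact mul_le_mul_of_nonneg_left (hM ω hω) hlam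
    have h := exp_abs_le_of_abs_le habs K
    rwa [abs_mul, abs_of_nonneg hlam] at h
  have hterm_int : ∀ k, k ≤ K → Integrable (fun ω => (lam * X ω) ^ (2 * k) / ((2 * k).factorial : ℝ)) μ := by
    intro k hk
    have := ((hint k hk).const_mul (lam ^ (2 * k))).div_const ((2 * k).factorial : ℝ)
    refine this.congr (ae_of_all _ fun ω => ?_)
    simp only [mul_pow]
  have hg_int : Integrable g μ := by
    refine ((integrable_finsetSum (range K) fun k hk => hterm_int k
      (le_of_lt (mem_range.1 hk))).const_mul 2).add ((hterm_int K le_rfl).const_mul _)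
  have hg_nonneg : 0 ≤ᵐ[μ] g := ae_of_all _ fun ω => by
    have h1 : 0 ≤ ∑ k ∈ range K, (lam * X ω) ^ (2 * k) / ((2 * k).factorial : ℝ) :=
      sum_nonneg fun k _ => cterm_nonneg _ k
    have h2 : 0 ≤ (lam * X ω) ^ (2 * K) / ((2 * K).factorial : ℝ) := cterm_nonneg _ K
    simp only [hg]; positivity
  -- integrability of the capped exponential on `S`
  have hexp_int : IntegrableOn (fun ω => Real.exp (lam * |X ω|)) S μ := by
    refine Measure.integrableOn_of_bounded (measure_ne_top μ S) ?_ (M := Real.exp (lam * M)) ?_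
    · exact Real.continuous_exp.comp_aestronglyMeasurable
        ((continuous_const.mul continuous_abs).comp_aestronglyMeasurable hX)
    refine (ae_restrict_iff' hS).2 (ae_of_all _ fun ω hω => ?_)
    rw [Real.norm_eq_abs, abs_of_nonneg (Real.exp_pos _).le]
    exact Real.exp_le_exp.2 (mul_le_mul_of_nonneg_left (hM ω hω) hlam)
  calc ∫ ω in S, Real.exp (lam * |X ω|) ∂μ ≤ ∫ ω in S, g ω ∂μ :=
        setIntegral_mono_on hexp_int hg_int.integrableOn hS hpt
    _ ≤ ∫ ω, g ω ∂μ := setIntegral_le_integral hg_int hg_nonneg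
    _ = 2 * ∑ k ∈ range K, lam ^ (2 * k) * (∫ ω, X ω ^ (2 * k) ∂μ) / ((2 * k).factorial : ℝ) +
        2 * Real.exp (lam * M) * (lam ^ (2 * K) * (∫ ω, X ω ^ (2 * K) ∂μ) / ((2 * K).factorial : ℝ)) := by
      simp only [hg]
      rw [integral_add ((integrable_finsetSum (range K) fun k hk => hterm_int k
        (le_of_lt (mem_range.1 hk))).const_mul 2) ((hterm_int K le_rfl).const_mul _),
        integral_const_mul, integral_const_mul, integral_finsetSum _ fun k hk => hterm_int k
        (le_of_lt (mem_range.1 hk))]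
      congr 1
      · congr 1
        refine sum_congr rfl fun k _ => ?_
        rw [integral_div, ← integral_const_mul]
        congr 1; refine integral_congr_ae (ae_of_all _ fun ω => ?_); simp only [mul_pow]
      · congr 1
        rw [integral_div, ← integral_const_mul]
        congr 1; refine integral_congr_ae (ae_of_all _ fun ω => ?_); simp only [mul_pow]

end Integral

/-! ## Hypercontractive arithmetic: the bound `2·μ(univ) + 20·Δ` -/

/-- The size parameter `Δ = e²·λ²·s·(λM+4)^{m−2}` (= `δ²` of the file header; `s = σ²`) is nonnegative. -/
theorem capDelta_nonneg {lam s M : ℝ} (hlam : 0 ≤ lam) (hs : 0 ≤ s) (hM : 0 ≤ M) (m : ℕ) :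
    0 ≤ Real.exp 1 ^ 2 * lam ^ 2 * s * (lam * M + 4) ^ (m - 2) := by
  have : 0 ≤ lam * M + 4 := by positivity
  positivity

/-- `e² < 7.39`. -/
theorem exp_one_sq_lt : Real.exp 1 ^ 2 < 7.39 := by
  have h := Real.exp_one_lt_d9
  have h0 := Real.exp_pos 1
  nlinarith

/-- `1/(2k)! ≤ e^{2k}/(2k)^{2k}`, from `(2k)^{2k}/(2k)! ≤ e^{2k}` (`Real.pow_div_factorial_le_exp`). -/
theorem inv_factorial_le (k : ℕ) (hk : 1 ≤ k) :
    (((2 * k).factorial : ℝ))⁻¹ ≤ Real.exp 1 ^ (2 * k) / ((2 * k : ℕ) : ℝ) ^ (2 * k) := by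
  have hpos : (0 : ℝ) < ((2 * k : ℕ) : ℝ) := by exact_mod_cast (by omega : 0 < 2 * k)
  have h := Real.pow_div_factorial_le_exp (x := ((2 * k : ℕ) : ℝ)) hpos.le (2 * k)
  rw [Real.exp_one_pow, le_div_iff₀ (pow_pos hpos _)]
  have hf : (0 : ℝ) < ((2 * k).factorial : ℝ) := by exact_mod_cast Nat.factorial_pos _
  rw [div_le_iff₀ hf] at h
  calc (((2 * k).factorial : ℝ))⁻¹ * ((2 * k : ℕ) : ℝ) ^ (2 * k)
      = ((2 * k : ℕ) : ℝ) ^ (2 * k) / ((2 * k).factorial : ℝ) := by rw [inv_mul_eq_div]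
    _ ≤ Real.exp (((2 * k : ℕ) : ℝ)) := by rw [div_le_iff₀ hf]; exact h

/-- **Term bound**: under the hypercontractive moment hypothesis, for `k ≥ 1`,
`λ^{2k}·E[X^{2k}]/(2k)! ≤ (e²λ²s(2k)^{m−2})^k`. -/
theorem term_le_pow {Ω : Type*} [MeasurableSpace Ω] {μ : Measure Ω} {X : Ω → ℝ} {lam s : ℝ} (hlam : 0 ≤ lam) (hs : 0 ≤ s)
    {m : ℕ} (hm : 2 ≤ m) {k : ℕ} (hk : 1 ≤ k)
    (hmom : ∫ ω, X ω ^ (2 * k) ∂μ ≤ (2 * k - 1 : ℝ) ^ (k * m) * s ^ k) :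
    lam ^ (2 * k) * (∫ ω, X ω ^ (2 * k) ∂μ) / ((2 * k).factorial : ℝ) ≤
      (Real.exp 1 ^ 2 * lam ^ 2 * s * ((2 * k : ℕ) : ℝ) ^ (m - 2)) ^ k := by
  set N : ℝ := ((2 * k : ℕ) : ℝ) with hN
  have hNpos : 0 < N := by rw [hN]; exact_mod_cast (by omega : 0 < 2 * k)
  have hmom' : ∫ ω, X ω ^ (2 * k) ∂μ ≤ N ^ (k * m) * s ^ k := by
    refine hmom.trans (mul_le_mul_of_nonneg_right ?_ (pow_nonneg hs _))
    have hk1 : (1 : ℝ) ≤ k := by exact_mod_cast hk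
    apply pow_le_pow_left₀ (by linarith)
    rw [hN]; push_cast; linarith
  have hfac : (((2 * k).factorial : ℝ))⁻¹ ≤ Real.exp 1 ^ (2 * k) / N ^ (2 * k) := inv_factorial_le k hk
  have hkm : k * m = 2 * k + k * (m - 2) := by zify [hm]; ring
  calc lam ^ (2 * k) * (∫ ω, X ω ^ (2 * k) ∂μ) / ((2 * k).factorial : ℝ)
      = lam ^ (2 * k) * (∫ ω, X ω ^ (2 * k) ∂μ) * (((2 * k).factorial : ℝ))⁻¹ := div_eq_mul_inv _ _
    _ ≤ lam ^ (2 * k) * (N ^ (k * m) * s ^ k) * (Real.exp 1 ^ (2 * k) / N ^ (2 * k)) := by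
        apply mul_le_mul (mul_le_mul_of_nonneg_left hmom' (pow_nonneg hlam _)) hfac
          (inv_nonneg.2 (by positivity)) (by positivity)
    _ = (Real.exp 1 ^ 2 * lam ^ 2 * s * N ^ (m - 2)) ^ k := by
        rw [hkm, pow_add, mul_pow, mul_pow, mul_pow, ← pow_mul, ← pow_mul, ← pow_mul,
          show (m - 2) * k = k * (m - 2) by ring]
        field_simp

/-- **Capped exponential moment from hypercontractive moments.**  Let `|X| ≤ M` on the measurable set `S`, all even powers of `X`
integrable, and `E_μ[X^{2k}] ≤ (2k−1)^{km}·s^k` for every `k ≥ 1` (Gaussian hypercontractivity for a degree-`m` polynomial chaos with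
`s = E X²`, `m ≥ 2`).  If `Δ := e²λ²s(λM+4)^{m−2} ≤ 1/9` then `∫_S e^{λ|X|} dμ ≤ 2·μ(univ) + 20·Δ`.
(The CAP CONDITION of STUB-PLAN-E §2 E(7b): `Δ → 0 ⟺ λ^m σ² M^{m−2} → 0`.) -/
theorem setIntegral_exp_mul_abs_le_of_moments {Ω : Type*} [MeasurableSpace Ω] (μ : Measure Ω) [IsFiniteMeasure μ]
    {S : Set Ω} (hS : MeasurableSet S) {X : Ω → ℝ} (hX : AEStronglyMeasurable X μ)
    {lam s M : ℝ} (hlam : 0 ≤ lam) (hs : 0 ≤ s) (hM : 0 ≤ M) (hbd : ∀ ω ∈ S, |X ω| ≤ M) {m : ℕ} (hm : 2 ≤ m)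
    (hint : ∀ k : ℕ, Integrable (fun ω => X ω ^ (2 * k)) μ)
    (hmom : ∀ k : ℕ, 1 ≤ k → ∫ ω, X ω ^ (2 * k) ∂μ ≤ (2 * k - 1 : ℝ) ^ (k * m) * s ^ k)
    (hΔ : Real.exp 1 ^ 2 * lam ^ 2 * s * (lam * M + 4) ^ (m - 2) ≤ 1 / 9) :
    ∫ ω in S, Real.exp (lam * |X ω|) ∂μ ≤
      2 * μ.real Set.univ + 20 * (Real.exp 1 ^ 2 * lam ^ 2 * s * (lam * M + 4) ^ (m - 2)) := by
  -- the truncation order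
  set K : ℕ := ⌈lam * M / 2⌉₊ + 1 with hK
  have hK1 : 1 ≤ K := by omega
  have hceil : lam * M / 2 ≤ (⌈lam * M / 2⌉₊ : ℝ) := Nat.le_ceil _
  have hceil' : (⌈lam * M / 2⌉₊ : ℝ) < lam * M / 2 + 1 := Nat.ceil_lt_add_one (by positivity)
  have hKR : (K : ℝ) = (⌈lam * M / 2⌉₊ : ℝ) + 1 := by rw [hK]; push_cast; ring
  have h2K : lam * M ≤ 2 * (K : ℝ) := by rw [hKR]; linarith
  have h2K' : ((2 * K : ℕ) : ℝ) ≤ lam * M + 4 := by push_cast; rw [hKR]; linarith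
  -- abbreviations
  set Δ := Real.exp 1 ^ 2 * lam ^ 2 * s * (lam * M + 4) ^ (m - 2) with hΔdef
  have hΔ0 : 0 ≤ Δ := capDelta_nonneg hlam hs hM m
  set D : ℕ → ℝ := fun k => Real.exp 1 ^ 2 * lam ^ 2 * s * ((2 * k : ℕ) : ℝ) ^ (m - 2) with hD
  have hD0 : ∀ k, 0 ≤ D k := fun k => by simp only [hD]; positivity
  have hDmono : ∀ k, k ≤ K → D k ≤ Δ := by
    intro k hk
    simp only [hD, hΔdef]
    apply mul_le_mul_of_nonneg_left _ (by positivity)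
    apply pow_le_pow_left₀ (by positivity)
    exact le_trans (by exact_mod_cast (by omega : 2 * k ≤ 2 * K)) h2K'
  set T : ℕ → ℝ := fun k => lam ^ (2 * k) * (∫ ω, X ω ^ (2 * k) ∂μ) / ((2 * k).factorial : ℝ) with hT
  have hTle : ∀ k, 1 ≤ k → k ≤ K → T k ≤ Δ ^ k := by
    intro k hk hkK
    calc T k ≤ D k ^ k := term_le_pow hlam hs hm hk (hmom k hk)
      _ ≤ Δ ^ k := pow_le_pow_left₀ (hD0 k) (hDmono k hkK) k
  have hT0 : T 0 = μ.real Set.univ := by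
    simp only [hT, pow_zero, mul_zero, Nat.factorial_zero, Nat.cast_one, div_one, one_mul, integral_const,
      smul_eq_mul, mul_one]
  -- the generic bound with this `K`
  have hmain := setIntegral_exp_mul_abs_le μ hS hX hlam hbd K (fun k _ => hint k)
  -- the finite sum
  have hsum : ∑ k ∈ range K, T k ≤ μ.real Set.univ + 9 / 8 * Δ := by
    have hsplit : ∑ k ∈ range K, T k = T 0 + ∑ k ∈ Ico 1 K, T k := by
      rw [Finset.range_eq_Ico]
      rw [← Finset.sum_Ico_consecutive T (Nat.zero_le 1) hK1]
      simp
    rw [hsplit, hT0]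
    have h1 : ∑ k ∈ Ico 1 K, T k ≤ ∑ k ∈ Ico 1 K, Δ ^ k :=
      Finset.sum_le_sum fun k hk => hTle k (Finset.mem_Ico.1 hk).1 (Finset.mem_Ico.1 hk).2.le
    have h2 : ∑ k ∈ Ico 1 K, Δ ^ k ≤ Δ ^ 1 / (1 - Δ) := geom_sum_Ico_le_of_lt_one hΔ0 (by linarith)
    have h3 : Δ ^ 1 / (1 - Δ) ≤ 9 / 8 * Δ := by
      rw [pow_one, div_le_iff₀ (by linarith)]
      nlinarith
    linarith
  -- the remainder
  have hrem : Real.exp (lam * M) * T K ≤ Real.exp 1 ^ 2 * Δ := by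
    have he : Real.exp (lam * M) ≤ (Real.exp 1 ^ 2) ^ K := by
      rw [← pow_mul, Real.exp_one_pow]
      exact Real.exp_le_exp.2 (by push_cast; linarith)
    have hTK : T K ≤ D K ^ K := term_le_pow hlam hs hm hK1 (hmom K hK1)
    have hprod : Real.exp (lam * M) * T K ≤ (Real.exp 1 ^ 2 * Δ) ^ K := by
      rw [mul_pow]
      have hTKnn : 0 ≤ T K := by
        simp only [hT]
        have : 0 ≤ ∫ ω, X ω ^ (2 * K) ∂μ := integral_nonneg fun ω => by
          simp only [Pi.zero_apply]; rw [pow_mul]; positivity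
        positivity
      exact mul_le_mul he (hTK.trans (pow_le_pow_left₀ (hD0 K) (hDmono K le_rfl) K))
        hTKnn (by positivity)
    have hsmall : Real.exp 1 ^ 2 * Δ ≤ 1 := by nlinarith [exp_one_sq_lt]
    exact hprod.trans (pow_le_of_le_one (by positivity) hsmall (by omega))
  -- assemble
  have hfinal : 2 * ∑ k ∈ range K, T k + 2 * Real.exp (lam * M) * T K ≤
      2 * μ.real Set.univ + 20 * Δ := by
    have := exp_one_sq_lt
    nlinarith
  calc ∫ ω in S, Real.exp (lam * |X ω|) ∂μ
      ≤ 2 * ∑ k ∈ range K, T k + 2 * Real.exp (lam * M) * T K := by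
        simpa only [hT, mul_assoc] using hmain
    _ ≤ 2 * μ.real Set.univ + 20 * Δ := hfinal

/-! ## The three-term split (no Hölder) and the abstract assembler of the second clause -/

section Assemble

variable {Ω : Type*} [MeasurableSpace Ω]

/-- **Abstract second clause, restricted form**: if on the measurable set `S` one has `|W| ≤ |X₁| + |X₂| + |X₃| + c₀`, `W` is
a.e.-strongly measurable and the three capped exponentials `e^{3λ|X_i|}` are integrable on `S`, then
`∫_S e^{λ|W|} dμ ≤ e^{λc₀} · (∫_S e^{3λ|X₁|} + ∫_S e^{3λ|X₂|} + ∫_S e^{3λ|X₃|}) / 3`. -/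
theorem setIntegral_exp_mul_abs_le_of_three (μ : Measure Ω) {S : Set Ω} (hS : MeasurableSet S)
    {W X₁ X₂ X₃ : Ω → ℝ} {lam c₀ : ℝ} (hlam : 0 ≤ lam)
    (hW : ∀ ω ∈ S, |W ω| ≤ |X₁ ω| + |X₂ ω| + |X₃ ω| + c₀) (hWm : AEStronglyMeasurable W μ)
    (h₁ : IntegrableOn (fun ω => Real.exp (3 * lam * |X₁ ω|)) S μ)
    (h₂ : IntegrableOn (fun ω => Real.exp (3 * lam * |X₂ ω|)) S μ)
    (h₃ : IntegrableOn (fun ω => Real.exp (3 * lam * |X₃ ω|)) S μ) :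
    ∫ ω in S, Real.exp (lam * |W ω|) ∂μ ≤
      Real.exp (lam * c₀) * ((∫ ω in S, Real.exp (3 * lam * |X₁ ω|) ∂μ) +
        (∫ ω in S, Real.exp (3 * lam * |X₂ ω|) ∂μ) + (∫ ω in S, Real.exp (3 * lam * |X₃ ω|) ∂μ)) / 3 := by
  set g : Ω → ℝ := fun ω => Real.exp (lam * c₀) *
    ((Real.exp (3 * lam * |X₁ ω|) + Real.exp (3 * lam * |X₂ ω|) + Real.exp (3 * lam * |X₃ ω|)) / 3) with hg
  have hpt : ∀ ω ∈ S, Real.exp (lam * |W ω|) ≤ g ω := by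
    intro ω hω
    have h1 : Real.exp (lam * |W ω|) ≤ Real.exp (lam * c₀ + (lam * |X₁ ω| + lam * |X₂ ω| + lam * |X₃ ω|)) :=
      Real.exp_le_exp.2 (by nlinarith [hW ω hω])
    rw [Real.exp_add] at h1
    refine h1.trans (mul_le_mul_of_nonneg_left ?_ (Real.exp_pos _).le)
    -- `e^{a+b+c} ≤ (e^{3a}+e^{3b}+e^{3c})/3` by the weighted AM–GM inequality (cf. the tree's
    -- `TransferSkeleton.exp_add_three_le`, re-derived inline to keep this file Mathlib-only)
    set a := lam * |X₁ ω|; set b := lam * |X₂ ω|; set c := lam * |X₃ ω|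
    have h := Real.geom_mean_le_arith_mean3_weighted (w₁ := 1/3) (w₂ := 1/3) (w₃ := 1/3)
      (p₁ := Real.exp (3 * a)) (p₂ := Real.exp (3 * b)) (p₃ := Real.exp (3 * c))
      (by norm_num) (by norm_num) (by norm_num) (Real.exp_pos _).le (Real.exp_pos _).le (Real.exp_pos _).le
      (by norm_num)
    have e1 : Real.exp (3 * a) ^ (1 / 3 : ℝ) = Real.exp a := by rw [← Real.exp_mul]; congr 1; ring
    have e2 : Real.exp (3 * b) ^ (1 / 3 : ℝ) = Real.exp b := by rw [← Real.exp_mul]; congr 1; ring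
    have e3 : Real.exp (3 * c) ^ (1 / 3 : ℝ) = Real.exp c := by rw [← Real.exp_mul]; congr 1; ring
    rw [e1, e2, e3, ← Real.exp_add, ← Real.exp_add] at h
    have e4 : 3 * a = 3 * lam * |X₁ ω| := by simp only [a]; ring
    have e5 : 3 * b = 3 * lam * |X₂ ω| := by simp only [b]; ring
    have e6 : 3 * c = 3 * lam * |X₃ ω| := by simp only [c]; ring
    rw [e4, e5, e6] at h
    linarith
  have hg_int : IntegrableOn g S μ := by
    simp only [hg]
    exact (((h₁.add h₂).add h₃).div_const 3).const_mul _
  have hexp_int : IntegrableOn (fun ω => Real.exp (lam * |W ω|)) S μ := by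
    refine Integrable.mono' hg_int ?_ ((ae_restrict_iff' hS).2 (ae_of_all _ fun ω hω => ?_))
    · exact (Real.continuous_exp.comp_aestronglyMeasurable
        ((continuous_const.mul continuous_abs).comp_aestronglyMeasurable hWm)).restrict
    · rw [Real.norm_eq_abs, abs_of_nonneg (Real.exp_pos _).le]; exact hpt ω hω
  calc ∫ ω in S, Real.exp (lam * |W ω|) ∂μ ≤ ∫ ω in S, g ω ∂μ := setIntegral_mono_on hexp_int hg_int hS hpt
    _ = _ := by
      simp only [hg]
      rw [integral_const_mul, integral_div, integral_add _ h₃, integral_add h₁ h₂]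
      · ring
      · exact h₁.add h₂

/-- The conditioned integral as a restricted one: `∫ f dμ[|S] = (μ.real S)⁻¹ · ∫_S f dμ`. -/
theorem integral_cond_eq_inv_mul_setIntegral' (μ : Measure Ω) (S : Set Ω) (f : Ω → ℝ) :
    ∫ ω, f ω ∂(μ[|S]) = (μ.real S)⁻¹ * ∫ ω in S, f ω ∂μ := by
  rw [ProbabilityTheory.cond, integral_smul_measure, ENNReal.toReal_inv, smul_eq_mul, measureReal_def]

/-- **Abstract second clause, conditioned form** (`ν = μ[|S]`): under the hypotheses of
`setIntegral_exp_mul_abs_le_of_three`, with `B_i := ∫_S e^{3λ|X_i|} dμ`,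
`∫ e^{λ|W|} dν ≤ (μ.real S)⁻¹ · e^{λc₀} · (B₁ + B₂ + B₃)/3`. -/
theorem integral_cond_exp_mul_abs_le_of_three (μ : Measure Ω) {S : Set Ω} (hS : MeasurableSet S)
    {W X₁ X₂ X₃ : Ω → ℝ} {lam c₀ : ℝ} (hlam : 0 ≤ lam)
    (hW : ∀ ω ∈ S, |W ω| ≤ |X₁ ω| + |X₂ ω| + |X₃ ω| + c₀) (hWm : AEStronglyMeasurable W μ)
    (h₁ : IntegrableOn (fun ω => Real.exp (3 * lam * |X₁ ω|)) S μ)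
    (h₂ : IntegrableOn (fun ω => Real.exp (3 * lam * |X₂ ω|)) S μ)
    (h₃ : IntegrableOn (fun ω => Real.exp (3 * lam * |X₃ ω|)) S μ) :
    ∫ ω, Real.exp (lam * |W ω|) ∂(μ[|S]) ≤
      (μ.real S)⁻¹ * (Real.exp (lam * c₀) * ((∫ ω in S, Real.exp (3 * lam * |X₁ ω|) ∂μ) +
        (∫ ω in S, Real.exp (3 * lam * |X₂ ω|) ∂μ) + (∫ ω in S, Real.exp (3 * lam * |X₃ ω|) ∂μ)) / 3) := by
  rw [integral_cond_eq_inv_mul_setIntegral']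
  exact mul_le_mul_of_nonneg_left (setIntegral_exp_mul_abs_le_of_three μ hS hlam hW hWm h₁ h₂ h₃)
    (inv_nonneg.2 measureReal_nonneg)

/-- **Numerical closing of the second clause**: if the event has mass `≥ 9/10`, the centring constant satisfies `e^{λc₀} ≤ 11/10`
and each of the three capped exponential moments is `≤ 2 + 1/5` (e.g. `2·μ(univ) + 20Δ_i` with `μ` a probability measure and
`Δ_i ≤ 1/100`), then the conditioned exponential moment is `≤ 4` — the constant of `TiltMoments`. -/
theorem cond_bound_le_four {p E B₁ B₂ B₃ : ℝ} (hp : 9 / 10 ≤ p) (hE0 : 0 ≤ E) (hE : E ≤ 11 / 10)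
    (hB₁ : B₁ ≤ 11 / 5) (hB₂ : B₂ ≤ 11 / 5) (hB₃ : B₃ ≤ 11 / 5) :
    p⁻¹ * (E * (B₁ + B₂ + B₃) / 3) ≤ 4 := by
  have hp0 : 0 < p := by linarith
  rw [inv_mul_le_iff₀ hp0]
  nlinarith

end Assemble

end Summit.QuantumFields.YangMills.Theorems.AllWindowsColdBox.CappedExpMoment

end
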